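import Literature.NumberTheory.LFunctions.BondarenkoHeap2026Section2Proofs
import Literature.NumberTheory.LFunctions.BondarenkoHeap2026Prop1TestFunction
import Literature.NumberTheory.LFunctions.BondarenkoHeap2026Prop1Archimedean
import Literature.NumberTheory.LFunctions.ZetaZeroBoxEnumeration
import Literature.NumberTheory.LFunctions.WeilZeroSum
import Mathlib.MeasureTheory.Integral.DominatedConvergence
import HarnessLib

/-!
# Bondarenko–Heap 2026, Proposition 1 — module (M2) "explicit sides": the zero side
# `Σ_γ B_{T,h}(γ) = I₁`, the prime side `= (2/π)·(prime sum)`, and `B̂_{T,h}(0) = h I₀`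

LABEL (cell `rh-crit`, corpus C5 `ah`): **NOT RH-BEARING.** Part (M2) of the four-module programme
(ruling R-g5-8/R-g5-14 of the cell) formalising the PROOF of Proposition 1 of [BondarenkoHeap2026]
(arXiv:2608.07399v1, §2.2, p. 6–7, TeX l.283–341; typed as the named fact
`BondarenkoHeap2026.proposition1`, which carries Mathlib's `RiemannHypothesis` as its own antecedent).
This module supplies the three RH-FREE identifications that turn the tree's Guinand–Weil formula
`Literature.NumberTheory.LFunctions.tsum_zeros_shift_eq_explicit` (applied at `t = 0` to the
complexified window integral `B_{T,h}`, module (M1)) into the printed statement: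

* (M2-a) **zero side** — `BondarenkoHeap2026.Prop1.hasSum_zeroSide_bWindow`: for `0 < h ≤ 2`
  (`h = 2πc/log T`) the sum over ALL non-trivial zeros `Σ_ρ m(ρ) B_{T,h}(γ_ρ)` converges and equals
  the corpus numerator `I₁ = ∫_ℝ N_h^{sym}(t) |R(t)|² W_T(t) dt` (`I1R`), where
  `B_{T,h}(u) = ∫_{|u−t|<h/2} |R|² W_T` is Section 2's `bWindow` ("`I₁ = Σ_γ B_{T,h}(γ)`", TeX l.286;
  an unconditional Tonelli identity: the zeros with `γ > 0` give `N(t+h/2) − N(t−h/2)`, their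
  conjugates give the window at `−t`);
* (M2-b) **prime side** — `BondarenkoHeap2026.Prop1.primeSide_eq_primeSum`: the prime term of the
  formula, `Σ_n Λ(n) n^{−1/2} (1/2π)(B̂(log n/2π) + B̂(−log n/2π))`, equals `(2/π)·S` with `S` the
  prime sum `primeSum` of Section 2 ("`B̂_{T,h}(ξ) = (sin πhξ/πξ) Σ_{m,n} r(m)r(n)(mn)^{−1/2}
  Ŵ_T(ξ + log(m/n)/2π)`", TeX l.291–296, and `g_h(k) = sin(½h log k)/log k`, l.338);
* (M2-c) **`B̂_{T,h}(0) = h · I₀`** — `BondarenkoHeap2026.Prop1.fourier_zero_eq_gapWidth_mul_I0R`.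

(M2-b) and (M2-c) are first stated for an ABSTRACT transform `FB : ℝ → ℂ` under the two Fourier
identities of module (M1) as hypotheses (verbatim the signatures `Prop1.fourier_BC_eq`,
`Prop1.fourier_normSq_mul_weight_eq` of `BondarenkoHeap2026Prop1TestFunction`), and then
instantiated at module (M1)'s complexified window integral `Prop1.BC` — the three terms of
`Prop1.explicit_formula_BC` verbatim: `Prop1.hasSum_zeroSide_BC` / `Prop1.tsum_zeroSide_BC_eq`
(zero side `= I₁`), `Prop1.primeSide_BC_eq_primeSum` (prime side `= (2/π)·S`),
`Prop1.fourier_BC_zero_eq_gapWidth_mul_I0R` (`B̂_{T,h}(0) = h I₀`) — for the assembly module (M4).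
Nothing here bears on the truth of RH. No definitions, no new named facts.

## References

* [BondarenkoHeap2026] A. Bondarenko, W. Heap, arXiv:2608.07399v1, §2.2, Proposition 1 and its
  proof (pp. 6–7; TeX l.283–341).
* [BalazardDeRoton2008] M. Balazard, A. de Roton, arXiv:0810.3587, Prop. 11 (the shape of the
  explicit formula used, via `ExplicitFormulaBandLimited.lean`).
-/

noncomputable section

open Filter MeasureTheory Set Complex Finset
open scoped Real Topology ComplexConjugate FourierTransform

namespace Literature.NumberTheory.LFunctions

namespace BondarenkoHeap2026

namespace Prop1

namespace ExplicitSides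

open ZetaZeros Extension

/-! ### (M2-a) The zero side: counting identity and Tonelli -/

/-- **`N_h(t)` as a sum over the non-trivial zeros**: for `h ≥ 0`,
`N(t + h/2) − N(t − h/2) = Σ_{ρ : 0 < γ, γ − h/2 ≤ t < γ + h/2} m(ρ)`, the sum running over all
non-trivial zeros (each listed once, weight `m(ρ)`). [cite: BondarenkoHeap2026, §2.1 p. 4 (N_h)] -/
theorem windowCount_eq_tsum {h : ℝ} (hh : 0 ≤ h) (t : ℝ) :
    windowCount h t = ∑' ρ : riemannZetaNontrivialZeros,
      (if 0 < (ρ : ℂ).im ∧ t ∈ Set.Ico ((ρ : ℂ).im - h / 2) ((ρ : ℂ).im + h / 2)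
        then (riemannZetaZeroOrder (ρ : ℂ) : ℝ) else 0) := by
  classical
  set D : Set ℂ := zetaZeroBox 0 (t + h / 2) \ zetaZeroBox 0 (t - h / 2) with hD
  have hDf : D.Finite := (zetaZeroBox_finite 0 (t + h / 2)).subset Set.sdiff_subset
  have hint : ((zetaZeroCount (t + h / 2) : ℤ) - zetaZeroCount (t - h / 2)) =
      ∑ᶠ ρ ∈ D, riemannZetaZeroOrder ρ :=
    Montgomery.zetaZeroCount_sub_eq_finsum (by linarith)
  rw [finsum_mem_eq_finite_toFinset_sum _ hDf] at hint
  have hcast : windowCount h t = ∑ ρ ∈ hDf.toFinset, (riemannZetaZeroOrder ρ : ℝ) := by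
    have := congrArg (fun z : ℤ ↦ (z : ℝ)) hint
    push_cast at this
    unfold windowCount
    exact this
  -- membership in `D` for a non-trivial zero
  have hmemD : ∀ ρ : riemannZetaNontrivialZeros,
      (ρ : ℂ) ∈ D ↔ (0 < (ρ : ℂ).im ∧ t ∈ Set.Ico ((ρ : ℂ).im - h / 2) ((ρ : ℂ).im + h / 2)) := by
    intro ρ
    have hz := riemannZetaNontrivialZeros.zeta_eq_zero ρ.2
    have hre0 := riemannZetaNontrivialZeros.re_pos ρ.2
    have hre1 := riemannZetaNontrivialZeros.re_lt_one ρ.2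
    constructor
    · rintro ⟨⟨_, _, _, h3, h4⟩, hnot⟩
      refine ⟨h3, ?_, ?_⟩
      · linarith
      · by_contra hle
        rw [not_lt] at hle
        exact hnot ⟨hz, hre0.le, hre1.le, h3, by linarith⟩
    · rintro ⟨h3, h4, h5⟩
      refine ⟨⟨hz, hre0.le, hre1.le, h3, by linarith⟩, ?_⟩
      rintro ⟨_, _, _, _, h6⟩
      linarith
  -- the tsum is a finite sum over the image of `D` in the subtype
  set s : Finset riemannZetaNontrivialZeros :=
    hDf.toFinset.subtype (· ∈ riemannZetaNontrivialZeros) with hs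
  have hsupp : ∀ ρ : riemannZetaNontrivialZeros, ρ ∉ s →
      (if 0 < (ρ : ℂ).im ∧ t ∈ Set.Ico ((ρ : ℂ).im - h / 2) ((ρ : ℂ).im + h / 2)
        then (riemannZetaZeroOrder (ρ : ℂ) : ℝ) else 0) = 0 := by
    intro ρ hρ
    rw [if_neg]
    intro hcond
    apply hρ
    rw [hs, Finset.mem_subtype, Set.Finite.mem_toFinset]
    exact (hmemD ρ).2 hcond
  rw [tsum_eq_sum hsupp]
  have hDZ : ∀ ρ ∈ hDf.toFinset, ρ ∈ riemannZetaNontrivialZeros := fun ρ hρ ↦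
    zetaZeroBox_subset_riemannZetaNontrivialZeros 0 (t + h / 2)
      ((Set.Finite.mem_toFinset hDf).1 hρ).1
  rw [hcast, ← Finset.sum_subtype_of_mem (fun ρ : ℂ ↦ (riemannZetaZeroOrder ρ : ℝ)) hDZ]
  refine Finset.sum_congr rfl fun ρ hρ ↦ ?_
  rw [if_pos]
  rw [Finset.mem_subtype, Set.Finite.mem_toFinset] at hρ
  exact (hmemD ρ).1 hρ

/-- `g = |R|² W_T` is even. [cite: BondarenkoHeap2026, §2.1 p. 6 (extension to ℝ)] -/
theorem normSq_mul_weight_neg (w : Bump) (B : ℕ) (r : ℕ → ℝ) (L T t : ℝ) :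
    ‖dirichletPoly r L (-t)‖ ^ 2 * weight w B T (-t) = ‖dirichletPoly r L t‖ ^ 2 * weight w B T t := by
  rw [norm_dirichletPoly_neg, weight_even]

/-- `B_{T,h}` is even: `B(−u) = B(u)` (`|R|² W_T` is even). [cite: BondarenkoHeap2026, §2.2 (4) p. 6] -/
theorem bWindow_neg (c : ℝ) (w : Bump) (B : ℕ) (r : ℕ → ℝ) (L T u : ℝ) :
    bWindow c w B r L T (-u) = bWindow c w B r L T u := by
  unfold bWindow
  rw [← integral_indicator measurableSet_Ioo, ← integral_indicator measurableSet_Ioo,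
    ← integral_neg_eq_self]
  refine integral_congr_ae (Eventually.of_forall fun t ↦ ?_)
  simp only [Set.indicator]
  have hmem : (-t ∈ Set.Ioo (-u - gapWidth c T / 2) (-u + gapWidth c T / 2)) ↔
      (t ∈ Set.Ioo (u - gapWidth c T / 2) (u + gapWidth c T / 2)) := by
    simp only [Set.mem_Ioo]
    constructor <;> rintro ⟨h1, h2⟩ <;> constructor <;> linarith
  by_cases ht : t ∈ Set.Ioo (u - gapWidth c T / 2) (u + gapWidth c T / 2)
  · rw [if_pos (hmem.mpr ht), if_pos ht, normSq_mul_weight_neg]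
  · rw [if_neg (fun h ↦ ht (hmem.mp h)), if_neg ht]

/-- **Integrability of `N_h(t) |R(t)|² W_T(t)`** for `0 ≤ h ≤ 2`, `T > 0` (`N_h ≪ log(|t|+4)`,
`|R| ≤ Σ|r(n)|`, `|t| W_T` integrable). [cite: BondarenkoHeap2026, §2.1 p. 6 (extension to ℝ)] -/
theorem integrable_windowCount_mul (c : ℝ) (w : Bump) (B : ℕ) (r : ℕ → ℝ) (L : ℝ) {T : ℝ}
    (hT : 0 < T) (hh0 : 0 ≤ gapWidth c T) (hh2 : gapWidth c T ≤ 2) :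
    Integrable fun t : ℝ ↦
      windowCount (gapWidth c T) t * (‖dirichletPoly r L t‖ ^ 2 * weight w B T t) := by
  obtain ⟨C₁, hC₁, hN⟩ := exists_windowCount_le_log
  set A₀ : ℝ := ∑ n ∈ Finset.Icc 1 ⌊L⌋₊, |r n| with hA₀
  have hA₀0 : 0 ≤ A₀ := Finset.sum_nonneg fun n _ ↦ abs_nonneg _
  have hdom : Integrable fun t : ℝ ↦ C₁ * A₀ ^ 2 * (|t| * weight w B T t + 4 * weight w B T t) :=
    ((integrable_abs_mul_weight w B hT).add ((integrable_weight w B hT).const_mul 4)).const_mul _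
  refine hdom.mono' ?_ (Eventually.of_forall fun t ↦ ?_)
  · exact ((measurable_windowCount _).aestronglyMeasurable).mul
      ((((continuous_dirichletPoly r L).norm.pow 2).mul (continuous_weight w B T)).aestronglyMeasurable)
  · have hW0 := weight_nonneg w B T t
    have hN0 := windowCount_nonneg hh0 t
    have hNt := hN (gapWidth c T) t hh0 hh2
    have hlog : Real.log (|t| + 4) ≤ |t| + 4 := by
      have := Real.log_le_sub_one_of_pos (show 0 < |t| + 4 by positivity)
      linarith
    have hR := Arch.norm_dirichletPoly_le_sum r L t
    have hR2 : ‖dirichletPoly r L t‖ ^ 2 ≤ A₀ ^ 2 := pow_le_pow_left₀ (norm_nonneg _) hR 2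
    rw [Real.norm_eq_abs, abs_of_nonneg (mul_nonneg hN0 (mul_nonneg (sq_nonneg _) hW0))]
    calc windowCount (gapWidth c T) t * (‖dirichletPoly r L t‖ ^ 2 * weight w B T t)
        ≤ (C₁ * (|t| + 4)) * (A₀ ^ 2 * weight w B T t) := by
          refine mul_le_mul (hNt.trans ?_) (by gcongr) (by positivity) (by positivity)
          exact mul_le_mul_of_nonneg_left hlog hC₁.le
      _ = C₁ * A₀ ^ 2 * (|t| * weight w B T t + 4 * weight w B T t) := by ring

/-- **The zero side, zeros with `γ > 0`**: `Σ_{γ > 0} m(ρ) B_{T,h}(γ) = ∫ N_h(t)|R(t)|²W_T(t) dt`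
(Tonelli; `0 ≤ h ≤ 2`, `T > 0`). [cite: BondarenkoHeap2026, §2.2 p. 6 ("I₁ = Σ_γ B_{T,h}(γ)")] -/
theorem hasSum_zeroSide_pos (c : ℝ) (w : Bump) (B : ℕ) (r : ℕ → ℝ) (L : ℝ) {T : ℝ} (hT : 0 < T)
    (hh0 : 0 ≤ gapWidth c T) (hh2 : gapWidth c T ≤ 2) :
    HasSum (fun ρ : riemannZetaNontrivialZeros ↦
        if 0 < (ρ : ℂ).im then (riemannZetaZeroOrder (ρ : ℂ) : ℝ) * bWindow c w B r L T (ρ : ℂ).im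
        else 0)
      (∫ t : ℝ, windowCount (gapWidth c T) t * (‖dirichletPoly r L t‖ ^ 2 * weight w B T t)) := by
  classical
  set h := gapWidth c T with hhdef
  set g : ℝ → ℝ := fun t ↦ ‖dirichletPoly r L t‖ ^ 2 * weight w B T t with hgdef
  have hg0 : ∀ t, 0 ≤ g t := fun t ↦ mul_nonneg (sq_nonneg _) (weight_nonneg w B T t)
  have hgc : Continuous g := ((continuous_dirichletPoly r L).norm.pow 2).mul (continuous_weight w B T)
  have hgi : Integrable g := by
    have h1 := integrable_weight w B hT
    set A₀ : ℝ := ∑ n ∈ Finset.Icc 1 ⌊L⌋₊, |r n|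
    refine (h1.const_mul (A₀ ^ 2)).mono' hgc.aestronglyMeasurable (Eventually.of_forall fun t ↦ ?_)
    rw [Real.norm_eq_abs, abs_of_nonneg (hg0 t), hgdef]
    have hR2 : ‖dirichletPoly r L t‖ ^ 2 ≤ A₀ ^ 2 :=
      pow_le_pow_left₀ (norm_nonneg _) (Arch.norm_dirichletPoly_le_sum r L t) 2
    exact mul_le_mul_of_nonneg_right hR2 (weight_nonneg w B T t)
  -- the coefficient and the window of each zero
  set cf : riemannZetaNontrivialZeros → ℝ := fun ρ ↦
    if 0 < (ρ : ℂ).im then (riemannZetaZeroOrder (ρ : ℂ) : ℝ) else 0 with hcf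
  have hcf0 : ∀ ρ, 0 ≤ cf ρ := fun ρ ↦ by
    simp only [hcf]
    split_ifs
    · exact_mod_cast riemannZetaZeroOrder_nonneg (riemannZetaNontrivialZeros.ne_one ρ.2)
    · exact le_rfl
  set F : riemannZetaNontrivialZeros → ℝ → ℝ := fun ρ t ↦
    cf ρ * (Set.Ico ((ρ : ℂ).im - h / 2) ((ρ : ℂ).im + h / 2)).indicator g t with hF
  have hF0 : ∀ ρ t, 0 ≤ F ρ t := fun ρ t ↦
    mul_nonneg (hcf0 ρ) (Set.indicator_nonneg (fun _ _ ↦ hg0 _) _)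
  have hFi : ∀ ρ, Integrable (F ρ) := fun ρ ↦
    (hgi.indicator measurableSet_Ico).const_mul _
  -- pointwise: `Σ_ρ F ρ t = N_h(t) g(t)`
  have hpt : ∀ t : ℝ, HasSum (fun ρ ↦ F ρ t) (windowCount h t * g t) := by
    intro t
    have heq : ∀ ρ : riemannZetaNontrivialZeros, F ρ t =
        (if 0 < (ρ : ℂ).im ∧ t ∈ Set.Ico ((ρ : ℂ).im - h / 2) ((ρ : ℂ).im + h / 2)
          then (riemannZetaZeroOrder (ρ : ℂ) : ℝ) else 0) * g t := by
      intro ρ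
      by_cases h1 : 0 < (ρ : ℂ).im <;>
        by_cases h2 : t ∈ Set.Ico ((ρ : ℂ).im - h / 2) ((ρ : ℂ).im + h / 2)
      · have hc : 0 < (ρ : ℂ).im ∧ t ∈ Set.Ico ((ρ : ℂ).im - h / 2) ((ρ : ℂ).im + h / 2) :=
          ⟨h1, h2⟩
        simp only [hF, hcf, if_pos h1, Set.indicator_of_mem h2, if_pos hc]
      · have hc : ¬(0 < (ρ : ℂ).im ∧ t ∈ Set.Ico ((ρ : ℂ).im - h / 2) ((ρ : ℂ).im + h / 2)) :=
          fun hc ↦ h2 hc.2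
        simp only [hF, hcf, if_pos h1, Set.indicator_of_notMem h2, if_neg hc, mul_zero, zero_mul]
      · have hc : ¬(0 < (ρ : ℂ).im ∧ t ∈ Set.Ico ((ρ : ℂ).im - h / 2) ((ρ : ℂ).im + h / 2)) :=
          fun hc ↦ h1 hc.1
        simp only [hF, hcf, if_neg h1, if_neg hc, zero_mul]
      · have hc : ¬(0 < (ρ : ℂ).im ∧ t ∈ Set.Ico ((ρ : ℂ).im - h / 2) ((ρ : ℂ).im + h / 2)) :=
          fun hc ↦ h1 hc.1
        simp only [hF, hcf, if_neg h1, if_neg hc, zero_mul]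
    simp_rw [heq]
    rw [windowCount_eq_tsum hh0 t]
    refine HasSum.mul_right (g t) ?_
    -- the counting family has finite support: the zeros in the window
    have hfin : (riemannZetaNontrivialZeros ∩ Metric.ball ((1 / 2 : ℂ) + t * Complex.I) (h / 2 + 2)).Finite :=
      riemannZetaNontrivialZeros_finite_inter_ball _ _
    have hfin' : {ρ : riemannZetaNontrivialZeros |
        (ρ : ℂ) ∈ Metric.ball ((1 / 2 : ℂ) + t * Complex.I) (h / 2 + 2)}.Finite := by
      have : {ρ : riemannZetaNontrivialZeros |
          (ρ : ℂ) ∈ Metric.ball ((1 / 2 : ℂ) + t * Complex.I) (h / 2 + 2)} =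
          Subtype.val ⁻¹' (riemannZetaNontrivialZeros ∩ Metric.ball ((1 / 2 : ℂ) + t * Complex.I) (h / 2 + 2)) := by
        ext ρ
        simp only [Set.mem_setOf_eq, Set.mem_preimage, Set.mem_inter_iff]
        exact ⟨fun hb ↦ ⟨ρ.2, hb⟩, fun hb ↦ hb.2⟩
      rw [this]
      exact hfin.preimage (Subtype.val_injective.injOn)
    have hs0 : ∀ ρ ∉ hfin'.toFinset,
        (if 0 < (ρ : ℂ).im ∧ t ∈ Set.Ico ((ρ : ℂ).im - h / 2) ((ρ : ℂ).im + h / 2)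
          then (riemannZetaZeroOrder (ρ : ℂ) : ℝ) else 0) = 0 := by
      intro ρ hρ
      rw [if_neg]
      intro hcond
      apply hρ
      rw [Set.Finite.mem_toFinset, Set.mem_setOf_eq, Metric.mem_ball, Complex.dist_eq]
      have hre0 := riemannZetaNontrivialZeros.re_pos ρ.2
      have hre1 := riemannZetaNontrivialZeros.re_lt_one ρ.2
      obtain ⟨_, h4, h5⟩ := hcond
      have hsub : (ρ : ℂ) - ((1 / 2 : ℂ) + t * Complex.I) =
          (((ρ : ℂ).re - 1 / 2 : ℝ) : ℂ) + (((ρ : ℂ).im - t : ℝ) : ℂ) * Complex.I := by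
        apply Complex.ext <;> simp
      rw [hsub]
      have him : |(ρ : ℂ).im - t| ≤ h / 2 := abs_le.mpr ⟨by linarith, by linarith⟩
      have hre : |(ρ : ℂ).re - 1 / 2| ≤ 1 / 2 := abs_le.mpr ⟨by linarith, by linarith⟩
      calc ‖((((ρ : ℂ).re - 1 / 2 : ℝ) : ℂ) + (((ρ : ℂ).im - t : ℝ) : ℂ) * Complex.I)‖
          ≤ ‖(((ρ : ℂ).re - 1 / 2 : ℝ) : ℂ)‖ + ‖(((ρ : ℂ).im - t : ℝ) : ℂ) * Complex.I‖ := norm_add_le _ _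
        _ = |(ρ : ℂ).re - 1 / 2| + |(ρ : ℂ).im - t| := by
            rw [norm_mul, Complex.norm_I, mul_one, Complex.norm_real, Complex.norm_real,
              Real.norm_eq_abs, Real.norm_eq_abs]
        _ < h / 2 + 2 := by linarith
    exact (summable_of_ne_finset_zero hs0).hasSum
  -- hence `t ↦ Σ' F ρ t` is `N_h g`, integrable
  have htsum : ∀ t, ∑' ρ, F ρ t = windowCount h t * g t := fun t ↦ (hpt t).tsum_eq
  have hNg : Integrable fun t ↦ windowCount h t * g t :=
    integrable_windowCount_mul c w B r L hT hh0 hh2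
  -- partial sums of `∫ F ρ` are bounded by `∫ N_h g`
  have hnorm : ∀ ρ, ∫ t, ‖F ρ t‖ = ∫ t, F ρ t := fun ρ ↦
    integral_congr_ae (Eventually.of_forall fun t ↦ by
      show ‖F ρ t‖ = F ρ t
      rw [Real.norm_eq_abs, abs_of_nonneg (hF0 ρ t)])
  have hsum : Summable fun ρ ↦ ∫ t, ‖F ρ t‖ := by
    simp_rw [hnorm]
    refine summable_of_sum_le (fun ρ ↦ integral_nonneg (hF0 ρ)) (c := ∫ t, windowCount h t * g t)
      fun u ↦ ?_
    rw [← integral_finsetSum u (fun ρ _ ↦ hFi ρ)]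
    refine integral_mono (integrable_finsetSum u fun ρ _ ↦ hFi ρ) hNg fun t ↦ ?_
    rw [← htsum t]
    exact (hpt t).summable.sum_le_tsum u fun ρ _ ↦ hF0 ρ t
  have hmain := hasSum_integral_of_summable_integral_norm hFi hsum
  -- identify both sides
  have hlhs : (fun ρ ↦ ∫ t, F ρ t) = fun ρ : riemannZetaNontrivialZeros ↦
      if 0 < (ρ : ℂ).im then (riemannZetaZeroOrder (ρ : ℂ) : ℝ) * bWindow c w B r L T (ρ : ℂ).im
      else 0 := by
    funext ρ
    simp only [hF, hcf]
    rw [integral_const_mul, integral_indicator measurableSet_Ico,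
      setIntegral_congr_set Ioo_ae_eq_Ico.symm]
    split_ifs with h1
    · rfl
    · rw [zero_mul]
  have hrhs : ∫ t, ∑' ρ, F ρ t = ∫ t, windowCount h t * g t :=
    integral_congr_ae (Eventually.of_forall htsum)
  rw [hlhs, hrhs] at hmain
  exact hmain


/-! ### (M2-b)/(M2-c) The prime side and `B̂(0)`: bookkeeping lemmas -/

/-- the window factor at a prime-power frequency: `h · sinc(π h · log k/2π) = 2 g_h(k)` for
`k ≥ 2`, `h ≠ 0` (`g_h(k) = sin(½ h log k)/log k`, TeX l.338).
[cite: BondarenkoHeap2026, Proposition 1 p. 7 (g_h, TeX l.338)] -/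
private theorem gapWidth_mul_sinc_eq {h : ℝ} (hh : h ≠ 0) {k : ℕ} (hk : 2 ≤ k) :
    h * Real.sinc (π * h * (Real.log k / (2 * π))) = 2 * gWeight h k := by
  have hlog : 0 < Real.log k := Real.log_pos (by exact_mod_cast hk)
  have hx : π * h * (Real.log k / (2 * π)) = h * Real.log k / 2 := by
    field_simp
  rw [hx, Real.sinc_of_ne_zero (div_ne_zero (mul_ne_zero hh hlog.ne') two_ne_zero), gWeight]
  field_simp

/-- frequency bookkeeping: `log k/2π + (log m − log n)/2π = log(km/n)/2π`. [folklore] -/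
private theorem logFreq_add {k m n : ℕ} (hk : 1 ≤ k) (hm : 1 ≤ m) (hn : 1 ≤ n) :
    Real.log k / (2 * π) + (Real.log m - Real.log n) / (2 * π) =
      Real.log ((k : ℝ) * m / n) / (2 * π) := by
  have hk0 : (0 : ℝ) < k := by exact_mod_cast hk
  have hm0 : (0 : ℝ) < m := by exact_mod_cast hm
  have hn0 : (0 : ℝ) < n := by exact_mod_cast hn
  rw [Real.log_div (mul_pos hk0 hm0).ne' hn0.ne', Real.log_mul hk0.ne' hm0.ne']
  ring

/-- frequency bookkeeping: `−log k/2π + (log m − log n)/2π = −log(kn/m)/2π`. [folklore] -/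
private theorem neg_logFreq_add {k m n : ℕ} (hk : 1 ≤ k) (hm : 1 ≤ m) (hn : 1 ≤ n) :
    -(Real.log k / (2 * π)) + (Real.log m - Real.log n) / (2 * π) =
      -(Real.log ((k : ℝ) * n / m) / (2 * π)) := by
  have hk0 : (0 : ℝ) < k := by exact_mod_cast hk
  have hm0 : (0 : ℝ) < m := by exact_mod_cast hm
  have hn0 : (0 : ℝ) < n := by exact_mod_cast hn
  rw [Real.log_div (mul_pos hk0 hn0).ne' hm0.ne', Real.log_mul hk0.ne' hn0.ne']
  ring

/-- the `m ↔ n` symmetry of the double sum: `Σ_{m,n} r(m)r(n)(mn)^{-1/2} Ŵ_T(−log(kn/m)/2π)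
= Σ_{m,n} r(m)r(n)(mn)^{-1/2} Ŵ_T(log(km/n)/2π)` (`Ŵ_T` even). [folklore] -/
private theorem doubleSum_swap (w : Bump) (B : ℕ) (r : ℕ → ℝ) (L T : ℝ) (k : ℕ) :
    ∑ m ∈ Finset.Icc 1 ⌊L⌋₊, ∑ n ∈ Finset.Icc 1 ⌊L⌋₊,
        r m * r n * ((m : ℝ) * n) ^ (-(1 / 2 : ℝ)) *
          weightHat w B T (-(Real.log ((k : ℝ) * n / m) / (2 * π))) =
      ∑ m ∈ Finset.Icc 1 ⌊L⌋₊, ∑ n ∈ Finset.Icc 1 ⌊L⌋₊,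
        r m * r n * ((m : ℝ) * n) ^ (-(1 / 2 : ℝ)) *
          weightHat w B T (Real.log ((k : ℝ) * m / n) / (2 * π)) := by
  rw [Finset.sum_comm]
  refine Finset.sum_congr rfl fun n _ ↦ Finset.sum_congr rfl fun m _ ↦ ?_
  rw [weightHat_even, mul_comm (r m) (r n), mul_comm (m : ℝ) (n : ℝ)]

/-- (2) for the real `Ŵ_T`: `Ŵ_T(ξ) = 0` for `|ξ| > 2σ/T`. [cite: BondarenkoHeap2026, §2.1 (2) p. 5] -/
private theorem weightHat_eq_zero_of_lt (w : Bump) (B : ℕ) {T : ℝ} (hT : 0 < T) {ξ : ℝ}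
    (hξ : 2 * w.σ / T < |ξ|) : weightHat w B T ξ = 0 := by
  have h := weightHat_support_holds w B T hT ξ hξ
  rw [← weightHat_eq] at h
  exact_mod_cast h

/-- **`𝓕(|R|²W_T)` at `± log k/2π`** in terms of the real `Ŵ_T`: both values equal
`Σ_{m,n ≤ L} r(m)r(n)(mn)^{-1/2} Ŵ_T(log(km/n)/2π)` (TeX l.291–296; for `−log k/2π` after the
swap `m ↔ n`, `Ŵ_T` being even). [cite: BondarenkoHeap2026, §2.2 p. 6 (TeX l.291–296)] -/
private theorem fourier_normSq_at_logFreq (w : Bump) (B : ℕ) (r : ℕ → ℝ) (L T : ℝ)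
    (hRW : ∀ ξ : ℝ, 𝓕 (fun t : ℝ ↦ (((‖dirichletPoly r L t‖ ^ 2 * weight w B T t : ℝ)) : ℂ)) ξ =
      ∑ m ∈ Finset.Icc 1 ⌊L⌋₊, ∑ n ∈ Finset.Icc 1 ⌊L⌋₊,
        ((r m * r n * ((m : ℝ) * n) ^ (-(1 / 2 : ℝ)) : ℝ) : ℂ) *
          𝓕 (fun t : ℝ ↦ (weight w B T t : ℂ)) (ξ + (Real.log m - Real.log n) / (2 * π)))
    {k : ℕ} (hk : 1 ≤ k) :
    𝓕 (fun t : ℝ ↦ (((‖dirichletPoly r L t‖ ^ 2 * weight w B T t : ℝ)) : ℂ))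
        (Real.log k / (2 * π)) =
      ((∑ m ∈ Finset.Icc 1 ⌊L⌋₊, ∑ n ∈ Finset.Icc 1 ⌊L⌋₊,
        r m * r n * ((m : ℝ) * n) ^ (-(1 / 2 : ℝ)) *
          weightHat w B T (Real.log ((k : ℝ) * m / n) / (2 * π)) : ℝ) : ℂ) ∧
    𝓕 (fun t : ℝ ↦ (((‖dirichletPoly r L t‖ ^ 2 * weight w B T t : ℝ)) : ℂ))
        (-(Real.log k / (2 * π))) =
      ((∑ m ∈ Finset.Icc 1 ⌊L⌋₊, ∑ n ∈ Finset.Icc 1 ⌊L⌋₊,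
        r m * r n * ((m : ℝ) * n) ^ (-(1 / 2 : ℝ)) *
          weightHat w B T (Real.log ((k : ℝ) * m / n) / (2 * π)) : ℝ) : ℂ) := by
  constructor
  · rw [hRW, Complex.ofReal_sum]
    refine Finset.sum_congr rfl fun m hm ↦ ?_
    rw [Complex.ofReal_sum]
    refine Finset.sum_congr rfl fun n hn ↦ ?_
    conv_rhs => rw [Complex.ofReal_mul, weightHat_eq]
    rw [logFreq_add hk (Finset.mem_Icc.mp hm).1 (Finset.mem_Icc.mp hn).1]
  · rw [hRW, ← doubleSum_swap w B r L T k, Complex.ofReal_sum]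
    refine Finset.sum_congr rfl fun m hm ↦ ?_
    rw [Complex.ofReal_sum]
    refine Finset.sum_congr rfl fun n hn ↦ ?_
    conv_rhs => rw [Complex.ofReal_mul, weightHat_eq]
    rw [neg_logFreq_add hk (Finset.mem_Icc.mp hm).1 (Finset.mem_Icc.mp hn).1]

/-- **the prime-side summand is finitely supported in `k`** (by (2)): for `m, n ≤ L` the term
`Λ(k) g_h(k) r(m)r(n)/√(kmn) · Ŵ_T(log(km/n)/2π)` vanishes once `k > L·exp(4πσ/T)`, so the
`k`-series is summable. [cite: BondarenkoHeap2026, §2.2 p. 7 (the k-sum is finite by (2))] -/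
private theorem summable_primeSummand (c : ℝ) (w : Bump) (B : ℕ) (r : ℕ → ℝ) (L : ℝ) {T : ℝ}
    (hT : 0 < T) {m n : ℕ} (hm : 1 ≤ m) (hn : n ∈ Finset.Icc 1 ⌊L⌋₊) :
    Summable fun k : ℕ ↦ ArithmeticFunction.vonMangoldt k * gWeight (gapWidth c T) k * r m * r n /
        Real.sqrt ((k : ℝ) * m * n) * weightHat w B T (Real.log ((k : ℝ) * m / n) / (2 * π)) := by
  obtain ⟨hn1, hnL⟩ := Finset.mem_Icc.mp hn
  have hL1 : 1 ≤ L := by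
    have : 0 < ⌊L⌋₊ := by omega
    exact (Nat.floor_pos.mp this)
  have hnL' : (n : ℝ) ≤ L := (Nat.cast_le.mpr hnL).trans (Nat.floor_le (by linarith))
  have hm0 : (0 : ℝ) < m := by exact_mod_cast hm
  have hn0 : (0 : ℝ) < n := by exact_mod_cast hn1
  set E : ℝ := Real.exp (4 * π * w.σ / T) with hE
  have hE0 : 0 < E := Real.exp_pos _
  refine summable_of_ne_finset_zero (s := Finset.range (⌈L * E⌉₊ + 1)) fun k hk ↦ ?_
  have hk : ⌈L * E⌉₊ + 1 ≤ k := by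
    simpa [Finset.mem_range, not_lt] using hk
  have hkE : L * E < k := by
    have h1 : L * E ≤ ⌈L * E⌉₊ := Nat.le_ceil _
    have h2 : ((⌈L * E⌉₊ + 1 : ℕ) : ℝ) ≤ k := by exact_mod_cast hk
    push_cast at h2
    linarith
  have hk0 : (0 : ℝ) < k := lt_of_le_of_lt (by positivity) hkE
  -- `k m / n > E`, hence `log(km/n) > 4πσ/T` and `|log(km/n)/2π| > 2σ/T`
  have hq : E < (k : ℝ) * m / n := by
    rw [lt_div_iff₀ hn0]
    calc E * n ≤ E * L := by gcongr
      _ = L * E := mul_comm _ _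
      _ < k := hkE
      _ = (k : ℝ) * 1 := (mul_one _).symm
      _ ≤ (k : ℝ) * m := by gcongr; exact_mod_cast hm
  have hlog : 4 * π * w.σ / T < Real.log ((k : ℝ) * m / n) := by
    rw [Real.lt_log_iff_exp_lt (by positivity)]
    exact hq
  have hξ : 2 * w.σ / T < |Real.log ((k : ℝ) * m / n) / (2 * π)| := by
    refine lt_of_lt_of_le ?_ (le_abs_self _)
    rw [lt_div_iff₀ (by positivity)]
    calc 2 * w.σ / T * (2 * π) = 4 * π * w.σ / T := by ring
      _ < Real.log ((k : ℝ) * m / n) := hlog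
  rw [weightHat_eq_zero_of_lt w B hT hξ, mul_zero]

end ExplicitSides

open ExplicitSides ZetaZeros Extension

/-! ### (M2-a) The zero side -/

/-- **The zero side** (M2-a): for `T > 0` and `0 ≤ h = 2πc/log T ≤ 2`,
`Σ_ρ m(ρ) B_{T,h}(γ_ρ) = I₁ = ∫_ℝ N_h^{sym}(t) |R(t)|² W_T(t) dt`, the sum over all non-trivial
zeros converging absolutely ("`I₁ = Σ_γ B_{T,h}(γ)`", the first line of the proof of
Proposition 1). Unconditional. [cite: BondarenkoHeap2026, §2.2 p. 6 (TeX l.283–288)] -/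
theorem hasSum_zeroSide_bWindow (c : ℝ) (w : Bump) (B : ℕ) (r : ℕ → ℝ) (L : ℝ) {T : ℝ}
    (hT : 0 < T) (hh0 : 0 ≤ gapWidth c T) (hh2 : gapWidth c T ≤ 2) :
    HasSum (fun ρ : riemannZetaNontrivialZeros ↦
        (riemannZetaZeroOrder (ρ : ℂ) : ℝ) * bWindow c w B r L T (ρ : ℂ).im)
      (I1R c w B r L T) := by
  set h := gapWidth c T with hhdef
  set g : ℝ → ℝ := fun t ↦ ‖dirichletPoly r L t‖ ^ 2 * weight w B T t with hgdef
  have hpos := hasSum_zeroSide_pos c w B r L hT hh0 hh2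
  -- the zeros with `γ < 0` by conjugation
  have hneg : HasSum (fun ρ : riemannZetaNontrivialZeros ↦
      if (ρ : ℂ).im < 0 then (riemannZetaZeroOrder (ρ : ℂ) : ℝ) * bWindow c w B r L T (ρ : ℂ).im
      else 0) (∫ t : ℝ, windowCount h t * g t) := by
    -- the conjugation involution of the non-trivial zeros
    set e : riemannZetaNontrivialZeros ≃ riemannZetaNontrivialZeros :=
      { toFun := fun ρ ↦ ⟨conj (ρ : ℂ), riemannZetaNontrivialZeros.conj_mem ρ.2⟩
        invFun := fun ρ ↦ ⟨conj (ρ : ℂ), riemannZetaNontrivialZeros.conj_mem ρ.2⟩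
        left_inv := fun ρ ↦ Subtype.ext (Complex.conj_conj _)
        right_inv := fun ρ ↦ Subtype.ext (Complex.conj_conj _) } with he
    have h2 := (e.hasSum_iff (f := fun ρ : riemannZetaNontrivialZeros ↦
      if 0 < (ρ : ℂ).im then (riemannZetaZeroOrder (ρ : ℂ) : ℝ) * bWindow c w B r L T (ρ : ℂ).im
      else 0)).mpr hpos
    have hfe : (fun ρ : riemannZetaNontrivialZeros ↦
        if (ρ : ℂ).im < 0 then (riemannZetaZeroOrder (ρ : ℂ) : ℝ) * bWindow c w B r L T (ρ : ℂ).im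
        else 0) =
        (fun ρ : riemannZetaNontrivialZeros ↦
          if 0 < (ρ : ℂ).im then (riemannZetaZeroOrder (ρ : ℂ) : ℝ) * bWindow c w B r L T (ρ : ℂ).im
          else 0) ∘ e := by
      funext ρ
      simp only [Function.comp_apply, he, Equiv.coe_fn_mk, Complex.conj_im, neg_pos]
      rw [riemannZetaZeroOrder_conj_holds, bWindow_neg]
    rw [hfe]
    exact h2
  -- add
  have hsum := hpos.add hneg
  have hfun : (fun ρ : riemannZetaNontrivialZeros ↦
      (if 0 < (ρ : ℂ).im then (riemannZetaZeroOrder (ρ : ℂ) : ℝ) * bWindow c w B r L T (ρ : ℂ).im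
        else 0) +
      (if (ρ : ℂ).im < 0 then (riemannZetaZeroOrder (ρ : ℂ) : ℝ) * bWindow c w B r L T (ρ : ℂ).im
        else 0)) =
      fun ρ : riemannZetaNontrivialZeros ↦
        (riemannZetaZeroOrder (ρ : ℂ) : ℝ) * bWindow c w B r L T (ρ : ℂ).im := by
    funext ρ
    have hne := riemannZetaNontrivialZeros.im_ne_zero ρ.2
    rcases lt_or_gt_of_ne hne with hlt | hgt
    · rw [if_neg (not_lt.mpr hlt.le), if_pos hlt, zero_add]
    · rw [if_pos hgt, if_neg (not_lt.mpr hgt.le), add_zero]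
  rw [hfun] at hsum
  -- the target: `I₁ = ∫ N_h g + ∫ N_h(−·) g`, and the second integral equals the first
  have hNg : Integrable fun t ↦ windowCount h t * g t :=
    integrable_windowCount_mul c w B r L hT hh0 hh2
  have hNg' : Integrable fun t ↦ windowCount h (-t) * g t := by
    have := hNg.comp_neg
    refine this.congr (Eventually.of_forall fun t ↦ ?_)
    simp only [hgdef, normSq_mul_weight_neg]
  have hI : I1R c w B r L T = (∫ t, windowCount h t * g t) + ∫ t, windowCount h (-t) * g t := by
    unfold I1R symWindowCount
    rw [← integral_add hNg hNg']
    refine integral_congr_ae (Eventually.of_forall fun t ↦ ?_)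
    simp only [hgdef]
    ring
  have hI2 : (∫ t, windowCount h (-t) * g t) = ∫ t, windowCount h t * g t := by
    rw [← integral_neg_eq_self]
    refine integral_congr_ae (Eventually.of_forall fun t ↦ ?_)
    simp only [neg_neg, hgdef, normSq_mul_weight_neg]
  rw [hI, hI2]
  exact hsum

/-! ### (M2-c) `B̂_{T,h}(0) = h · I₀` -/

/-- **`B̂_{T,h}(0) = h I₀`** (used at "`−B̂_{T,h}(0) log π`", p. 6, and in the last display of
the proof, p. 7): for any transform `FB` satisfying module (M1)'s convolution identity
`FB(ξ) = 𝓕(|R|²W_T)(ξ) · h sinc(πhξ)` (`fourier_BC_eq`), `FB(0) = h · ∫|R|²W_T = h · I₀`.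
[cite: BondarenkoHeap2026, §2.2 p. 7 (TeX l.318–326, B̂_{T,h}(0) = h I₀)] -/
theorem fourier_zero_eq_gapWidth_mul_I0R (c : ℝ) (w : Bump) (B : ℕ) (r : ℕ → ℝ) (L T : ℝ)
    {FB : ℝ → ℂ}
    (hBC : ∀ ξ : ℝ, FB ξ =
      𝓕 (fun t : ℝ ↦ (((‖dirichletPoly r L t‖ ^ 2 * weight w B T t : ℝ)) : ℂ)) ξ *
        ((gapWidth c T * Real.sinc (π * gapWidth c T * ξ) : ℝ) : ℂ)) :
    FB 0 = ((gapWidth c T * I0R w B r L T : ℝ) : ℂ) := by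
  rw [hBC, mul_zero, Real.sinc_zero, mul_one, Real.fourier_real_eq_integral_exp_smul]
  simp only [mul_zero, Complex.ofReal_zero, zero_mul, Complex.exp_zero, one_smul]
  rw [integral_complex_ofReal, I0R, Complex.ofReal_mul, mul_comm]

/-! ### (M2-b) The prime side -/

/-- **The prime side** (M2-b): for any transform `FB` satisfying module (M1)'s two Fourier
identities — `FB(ξ) = 𝓕(|R|²W_T)(ξ)·h sinc(πhξ)` (`fourier_BC_eq`) and
`𝓕(|R|²W_T)(ξ) = Σ_{m,n ≤ L} r(m)r(n)(mn)^{-1/2} Ŵ_T(ξ + (log m − log n)/2π)`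
(`fourier_normSq_mul_weight_eq`), i.e. "`B̂_{T,h}(ξ) = (sin πhξ/πξ) Σ_{m,n} r(m)r(n)(mn)^{-1/2}
Ŵ_T(ξ + log(m/n)/2π)`" (TeX l.291–296) — the prime term of the explicit formula equals `(2/π)·S`,
`S = Σ_{m,n ≤ L, k ≥ 2} Λ(k) g_h(k) r(m)r(n)/√(kmn) · Ŵ_T(log(km/n)/2π)` (`primeSum`; "`−2 Σ_n
Λ(n)/√n Re B̂_{T,h}(log n/2π)`", p. 6, with `g_h(k) = sin(½h log k)/log k`, TeX l.338; here
`B̂(−ξ) = B̂(ξ)` replaces `2 Re`). For `h = 2πc/log T > 0`; the `k`-sum is finite by (2).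
[cite: BondarenkoHeap2026, §2.2 pp. 6–7 (TeX l.289–296, 330–338)] -/
theorem primeSide_eq_primeSum (c : ℝ) (w : Bump) (B : ℕ) (r : ℕ → ℝ) (L : ℝ) {T : ℝ}
    (hT : 0 < T) (hh : 0 < gapWidth c T) {FB : ℝ → ℂ}
    (hBC : ∀ ξ : ℝ, FB ξ =
      𝓕 (fun t : ℝ ↦ (((‖dirichletPoly r L t‖ ^ 2 * weight w B T t : ℝ)) : ℂ)) ξ *
        ((gapWidth c T * Real.sinc (π * gapWidth c T * ξ) : ℝ) : ℂ))
    (hRW : ∀ ξ : ℝ, 𝓕 (fun t : ℝ ↦ (((‖dirichletPoly r L t‖ ^ 2 * weight w B T t : ℝ)) : ℂ)) ξ =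
      ∑ m ∈ Finset.Icc 1 ⌊L⌋₊, ∑ n ∈ Finset.Icc 1 ⌊L⌋₊,
        ((r m * r n * ((m : ℝ) * n) ^ (-(1 / 2 : ℝ)) : ℝ) : ℂ) *
          𝓕 (fun t : ℝ ↦ (weight w B T t : ℂ)) (ξ + (Real.log m - Real.log n) / (2 * π))) :
    ∑' n : ℕ, ((ArithmeticFunction.vonMangoldt n : ℝ) : ℂ) / (Real.sqrt n : ℂ) *
        ((1 / (2 * π) : ℂ) * (FB (Real.log n / (2 * π)) + FB (-(Real.log n / (2 * π))))) =
      ((2 / π * primeSum c w B r L T : ℝ) : ℂ) := by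
  classical
  set h := gapWidth c T with hhdef
  set N := Finset.Icc 1 ⌊L⌋₊ with hN
  -- Step 1: the termwise identity `Λ(k)/√k · (1/2π)(FB(ξ_k) + FB(−ξ_k)) = (2/π) Σ_{m,n} a(k,m,n)`
  have hterm : ∀ k : ℕ,
      ((ArithmeticFunction.vonMangoldt k : ℝ) : ℂ) / (Real.sqrt k : ℂ) *
          ((1 / (2 * π) : ℂ) * (FB (Real.log k / (2 * π)) + FB (-(Real.log k / (2 * π))))) =
        ((2 / π * ∑ m ∈ N, ∑ n ∈ N, ArithmeticFunction.vonMangoldt k * gWeight h k * r m * r n /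
            Real.sqrt ((k : ℝ) * m * n) *
              weightHat w B T (Real.log ((k : ℝ) * m / n) / (2 * π)) : ℝ) : ℂ) := by
    intro k
    rcases lt_or_ge k 2 with hk | hk
    · have hΛ : ArithmeticFunction.vonMangoldt k = 0 := by
        interval_cases k
        · exact ArithmeticFunction.map_zero
        · exact ArithmeticFunction.vonMangoldt_apply_one
      simp [hΛ]
    · have hk1 : 1 ≤ k := by omega
      obtain ⟨hpos, hneg⟩ := fourier_normSq_at_logFreq w B r L T hRW hk1
      rw [hBC, hBC, hpos, hneg, mul_neg, Real.sinc_neg, gapWidth_mul_sinc_eq hh.ne' hk]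
      have hk0 : (0 : ℝ) < k := by exact_mod_cast hk1
      have hreal :
          ArithmeticFunction.vonMangoldt k / Real.sqrt k * (1 / (2 * π) *
            ((∑ m ∈ N, ∑ n ∈ N, r m * r n * ((m : ℝ) * n) ^ (-(1 / 2 : ℝ)) *
                weightHat w B T (Real.log ((k : ℝ) * m / n) / (2 * π))) * (2 * gWeight h k) +
             (∑ m ∈ N, ∑ n ∈ N, r m * r n * ((m : ℝ) * n) ^ (-(1 / 2 : ℝ)) *
                weightHat w B T (Real.log ((k : ℝ) * m / n) / (2 * π))) * (2 * gWeight h k))) =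
          2 / π * ∑ m ∈ N, ∑ n ∈ N, ArithmeticFunction.vonMangoldt k * gWeight h k * r m * r n /
            Real.sqrt ((k : ℝ) * m * n) *
              weightHat w B T (Real.log ((k : ℝ) * m / n) / (2 * π)) := by
        have e1 : ∀ S : ℝ, ArithmeticFunction.vonMangoldt k / Real.sqrt k * (1 / (2 * π) *
            (S * (2 * gWeight h k) + S * (2 * gWeight h k))) =
            2 / π * (ArithmeticFunction.vonMangoldt k * gWeight h k / Real.sqrt k * S) := by
          intro S
          field_simp
          ring
        rw [e1, Finset.mul_sum]
        congr 1
        refine Finset.sum_congr rfl fun m hm ↦ ?_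
        rw [Finset.mul_sum]
        refine Finset.sum_congr rfl fun n hn ↦ ?_
        have hm0 : (0 : ℝ) < m := by exact_mod_cast (Finset.mem_Icc.mp hm).1
        have hn0 : (0 : ℝ) < n := by exact_mod_cast (Finset.mem_Icc.mp hn).1
        rw [Real.rpow_neg (mul_nonneg hm0.le hn0.le), ← Real.sqrt_eq_rpow,
          Real.sqrt_mul (mul_nonneg hk0.le hm0.le) (n : ℝ), Real.sqrt_mul hk0.le (m : ℝ),
          Real.sqrt_mul hm0.le (n : ℝ)]
        have h1 : Real.sqrt k ≠ 0 := (Real.sqrt_pos.mpr hk0).ne'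
        have h2 : Real.sqrt m ≠ 0 := (Real.sqrt_pos.mpr hm0).ne'
        have h3 : Real.sqrt n ≠ 0 := (Real.sqrt_pos.mpr hn0).ne'
        field_simp
      exact_mod_cast hreal
  -- Step 2: sum over `k` and exchange with the finite `m, n`-sums (finite support by (2))
  rw [tsum_congr hterm, ← Complex.ofReal_tsum, tsum_mul_left]
  congr 2
  rw [primeSum, Summable.tsum_finsetSum (fun m hm ↦ summable_sum fun n hn ↦
    summable_primeSummand c w B r L hT (Finset.mem_Icc.mp hm).1 hn)]
  refine Finset.sum_congr rfl fun m hm ↦ ?_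
  rw [Summable.tsum_finsetSum (fun n hn ↦
    summable_primeSummand c w B r L hT (Finset.mem_Icc.mp hm).1 hn)]

/-! ### The three sides instantiated at module (M1)'s `B_{T,h}` (for the assembly, module (M4)) -/

/-- **Zero side of the explicit formula for `B_{T,h}`**: the left-hand side of
`Prop1.explicit_formula_BC`, `Σ_ρ m(ρ) B_{T,h}(γ_ρ)` with `B_{T,h}` the complexified window
integral `BC` of module (M1), sums to `I₁` (`T > 0`, `0 ≤ h ≤ 2`).
[cite: BondarenkoHeap2026, §2.2 p. 6 (TeX l.283–288, I₁ = Σ_γ B_{T,h}(γ))] -/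
theorem hasSum_zeroSide_BC (c : ℝ) (w : Bump) (B : ℕ) (r : ℕ → ℝ) (L : ℝ) {T : ℝ}
    (hT : 0 < T) (hh0 : 0 ≤ gapWidth c T) (hh2 : gapWidth c T ≤ 2) :
    HasSum (fun ρ : riemannZetaNontrivialZeros ↦
        (riemannZetaZeroOrder (ρ : ℂ) : ℂ) * BC c w B r L T (((ρ : ℂ).im : ℝ) : ℂ))
      ((I1R c w B r L T : ℝ) : ℂ) := by
  refine (Complex.hasSum_ofReal.mpr (hasSum_zeroSide_bWindow c w B r L hT hh0 hh2)).congr_fun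
    fun ρ ↦ ?_
  rw [BC_ofReal hh0, integral_Icc_eq_integral_Ioo, bWindow]
  push_cast
  ring

/-- `Σ_ρ m(ρ) B_{T,h}(γ_ρ) = I₁` as an equation of `tsum`s (the form module (M4) rewrites with).
[cite: BondarenkoHeap2026, §2.2 p. 6 (TeX l.283–288)] -/
theorem tsum_zeroSide_BC_eq (c : ℝ) (w : Bump) (B : ℕ) (r : ℕ → ℝ) (L : ℝ) {T : ℝ}
    (hT : 0 < T) (hh0 : 0 ≤ gapWidth c T) (hh2 : gapWidth c T ≤ 2) :
    ∑' ρ : riemannZetaNontrivialZeros,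
        (riemannZetaZeroOrder (ρ : ℂ) : ℂ) * BC c w B r L T (((ρ : ℂ).im : ℝ) : ℂ) =
      ((I1R c w B r L T : ℝ) : ℂ) :=
  (hasSum_zeroSide_BC c w B r L hT hh0 hh2).tsum_eq

/-- **`B̂_{T,h}(0) = h I₀`** for module (M1)'s `B_{T,h}` (`T > 0`, `h > 0`).
[cite: BondarenkoHeap2026, §2.2 p. 7 (TeX l.318–326)] -/
theorem fourier_BC_zero_eq_gapWidth_mul_I0R {c T : ℝ} (hT : 0 < T) (hh : 0 < gapWidth c T) (w : Bump) (B : ℕ)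
    (r : ℕ → ℝ) (L : ℝ) :
    𝓕 (fun u : ℝ ↦ BC c w B r L T u) 0 = ((gapWidth c T * I0R w B r L T : ℝ) : ℂ) :=
  fourier_zero_eq_gapWidth_mul_I0R c w B r L T (FB := fun ξ ↦ 𝓕 (fun u : ℝ ↦ BC c w B r L T u) ξ)
    (fourier_BC_eq hT hh w B r L)

/-- **Prime side of the explicit formula for `B_{T,h}`** = `(2/π)·S` for module (M1)'s `B_{T,h}`
(`T > 0`, `h > 0`): the prime term of `Prop1.explicit_formula_BC` verbatim.
[cite: BondarenkoHeap2026, §2.2 pp. 6–7 (TeX l.289–296, 330–338)] -/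
theorem primeSide_BC_eq_primeSum {c T : ℝ} (hT : 0 < T) (hh : 0 < gapWidth c T) (w : Bump)
    (B : ℕ) (r : ℕ → ℝ) (L : ℝ) :
    ∑' n : ℕ, ((ArithmeticFunction.vonMangoldt n : ℝ) : ℂ) / (Real.sqrt n : ℂ) *
        ((1 / (2 * π) : ℂ) * (𝓕 (fun x : ℝ ↦ BC c w B r L T x) (Real.log n / (2 * π))
          + 𝓕 (fun x : ℝ ↦ BC c w B r L T x) (-(Real.log n / (2 * π))))) =
      ((2 / π * primeSum c w B r L T : ℝ) : ℂ) :=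
  primeSide_eq_primeSum c w B r L hT hh (FB := fun ξ ↦ 𝓕 (fun x : ℝ ↦ BC c w B r L T x) ξ)
    (fourier_BC_eq hT hh w B r L) (fourier_normSq_mul_weight_eq w B r L hT)


end Prop1

end BondarenkoHeap2026

end Literature.NumberTheory.LFunctions
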